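import Literature.MathematicalPhysics.QuantumFieldTheory.Balaban1983to89.Node00.Record12BgRowCoClassGaugeRFloor
import Summits.QuantumFields.YangMills.Theorems.BalabanUVNodesN07Thm1Top7FromProp8Floor
import Summits.QuantumFields.YangMills.Theorems.BalabanUVNodesK0GenericCubeOfStepTokensR

/-!
# K0⁷ — THE ALL-TORUS K0 BODY AT `θ₁₅ᶜᶜᴹ(j; γ)` AND THE (j, c)-GENERIC STUB COMPOSITION, RE-KEYED ON THE FLOOR-CARRYING (8)-SENTENCE
# `VariationalThm1RegSepCoP7MR F N c B₃ a₀ a₁` (V20 option R: stub 1 `∃ c B₃ a₀ a₁, … ∧ Prop8RegSepTopStepR F 2 suppDom c B₃ a₀ a₁`)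

Cell `pub-ymgap`, seat `pub-ymgap-k0-s1-w3` generation 7 (K0⁷ `stmt-QuantumFields-20541`, V19 stub 1 `stub_prop8StepCoP13` helper lane;
`--kind proof --supports stmt-QuantumFields-20541 --as helper`).  NEW leaf, theorems only (0 `def`, 0 `sorry`); nothing in the tree is modified.

WHY.  dag-n07-e's LOCATED-STUB1-FLOOR (2026-08-28): the stub-1 chain of [15] Sect. F at NODE 00's objects is floor-free in `ν.M₁` while every per-datum supplier of the
S6 head carries print's floor «R₁M₁ sufficiently big» ([15] p. 304 lines 1–2); the repair of record (plan (R-b), lane owner's `V20-STUB1-TEXT-PROPOSAL.md`) re-texts stub 1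
with the floor `c ≤ ν.M₁` ∃-bound OUTERMOST — option R: `∃ (c : ℕ) (B₃ a₀ a₁ : ℝ), 2L² ≤ B₃ ∧ 0 < a₀ ∧ 0 < a₁ ∧ Prop8RegSepTopStepR F 2 suppDom c B₃ a₀ a₁` (module 46
`Node00/CriticalOnFibreTopFloor`) — and gives stub 3ᴬ′ the floor-carrying first antecedent `VariationalThm1RegSepCoP7MR F 2 c B₃ a₀ a₁` at the SAME `c` as its (9)-antecedent.
Every R-letter the K0 body needs is in the tree (n07-e modules 46∕48∕49∕50, the Summits (8)-bridge `…N07Thm1Top7FromProp8Floor`); the ONE untyped link was the K0-BODY SIDE: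
dag-n21-c's all-torus closer chain (`Node00/Record13SepCoPInhabitedOfThm1CCMWGaugeRAllTorus`, p575996) and PART 1 (`…K0GenericCubeOfStepTokensR`, p589753) read the floor-FREE
`h15 : VariationalThm1RegSepCoP7M`.  THIS FILE is that chain with `h15 ↦ h15R : VariationalThm1RegSepCoP7MR F N c B₃ a₀ a₁` at the floor `c` those theorems ALREADY carry for the
gauge sentence (`hc : c ≤ θ.ν.M₁`, resp. `c ≤ L^j = ν.M₁(θ₁₅ᶜᶜᴹ(j))`): statements otherwise VERBATIM, proofs the originals' with n07-e's module 50
`bgRowAtDatumCoP_of_thm1RegSepCoP7MR_of_thm1GaugeR` at the one application.  §4 is PART 1 §2–§4 re-keyed the same way (stub-level composition with a GENERIC R-supplier; NODE O's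
jets-free socket on the R text); §5 displays the direction of the re-text (V19 stub 1 ⇒ V20-R stub 1; V20-R 3ᴬ′ ⇒ V19 3ᴬ′ — the R text of stub 3 is the STRONGER one).
PART 2-R (stub 2′ fills the R-supplier slot; the three-stub composition `record13SepCoPHBody_of_stubs1R_2P_3A'R`) is the sibling file `…K0PrintCubeOfStepTokensRFloor`.

CONTENTS.  §1 ★ `bgAtDatumCoP_of_thm1RegSepCoP7MR_of_thm1GaugeR_allTorus` (p575996 §2 at `h15R`).  §2 ★★ `bgSepCoPAt_theta13OfThm1CCMW_of_thm1RegSepCoP7MR_of_thm1GaugeR_of_hcomp_allTorus`.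
§3 closers `exists_k0SepCoP{,H}_thm1CCMW_of_thm1RegSepCoP7MR_of_thm1GaugeR_of_hcomp_allTorus`, `exists_k0SepCoPH_thm1CCMW_of_thm1RegSepCoP7MR_of_gauge9TopStepR_of_hcomp_allTorus`.
§4 ★ `exists_k0H_of_thm1CoP7MR_of_gauge9R_of_absBox`, ★★ `record13SepCoPHBody_of_stub1R_of_gauge9SupplierR_of_absBetaBoxAtR`, `absBetaBoxAtR_of_jetsFreePairAtR`.
§5 `prop8StepCoPR_of_prop8StepCoP`, `absBetaBoxAtGen_of_absBetaBoxAtGenR`.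

HONEST FRAMING: count-neutral kernel re-keying BY NAME; every [15]∕[6]∕[I] sentence is a HYPOTHESIS (a `Prop`, never asserted, inhabited nowhere here); the compositions are
CONDITIONAL on the stub texts; `stub_prop8StepCoP13` ∕ K0⁷ ∕ K1⁹ NOT closed; N07 NOT discharged; counts unmoved (typed 28∕28 · discharged 5∕27); the route closes only the
conditional finite-𝕋⁴ rung `BalabanLadder.UV` — the YM mass gap (Clay) is NOT proved by any of this; nothing continuum ∕ ℝ⁴ ∕ OS.  No `sorry`, `def`, `instance`, `notation`.
[15] = Bałaban, CMP 102 (1985) 277–309 [Balaban1985Variational]; [6] = CMP 99 (1985) 75 [Balaban1985RegularSpaces]; [III] = CMP 119 (1988) 243 [Balaban1988Convergent];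
[I] = CMP 109 (1987) 249 [Balaban1987RG1]; [II] = CMP 122 (1989) 355 [Balaban1989LargeFieldII]; [RG2] = CMP 116 (1988) 1 [Balaban1988RG2Cluster].
-/

noncomputable section

open MeasureTheory
open scoped Matrix.Norms.L2Operator

namespace Summit.QuantumFields.YangMills.Theorems.K0AllTorusOfStepTokensRFloor

open Literature.MathematicalPhysics.QuantumFieldTheory.Balaban1983to89
open Literature.MathematicalPhysics.QuantumFieldTheory.Balaban1983to89.Node00
open Literature.MathematicalPhysics.QuantumFieldTheory.Balaban1983to89.T4Continuum
open Literature.MathematicalPhysics.QuantumFieldTheory.Balaban1983to89.FlowStep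
open Literature.MathematicalPhysics.QuantumFieldTheory.Balaban1983to89.FlowStepRuns
open Literature.MathematicalPhysics.QuantumFieldTheory.Balaban1983to89.B14.Eq218Concrete
open Literature.MathematicalPhysics.QuantumFieldTheory.Balaban1983to89.B15DeterminingSets
open Literature.MathematicalPhysics.QuantumFieldTheory.Balaban1983to89.B12RegularSpaces111
open Literature.MathematicalPhysics.QuantumFieldTheory.Balaban1983to89.B14RegularSpaces234
open Literature.MathematicalPhysics.QuantumFieldTheory.Balaban1983to89.Beta.Drift (OneLoopDrift)
open Summit.QuantumFields.BalabanUV.Gaps.BetaContFromD4Chain (AtSlopeCont)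
open Summit.QuantumFields.YangMills.BalabanUVNodes.N07Thm1Top7FromProp8 (variationalThm1RegSepCoP7MR_of_prop8TopStepR)
open Summit.QuantumFields.YangMills.Theorems.K0GenericCubeOfStepTokensR (clausesH_of_absBox)
open Summit.QuantumFields.YangMills.Theorems.BalabanUVNodesN26AtRecord13BetaBoxOfDriftAtSlope (exists_betaBox_betaOfRecord₁₃_of_jetsFreePair)

/-! ## §1  ★ B′'s Stage-13 reduction on every family (p575996 §2), keyed on the FLOOR-CARRYING (8) `CoP` sentence -/

section LiftGaugeRAllTorusFloor

variable {F : T4Family} {N : ℕ} [NeZero N]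

/-- **★ ROW P11's BODY AT `UbgMSCoPOfRecord … n s 𝐖` AT THE STAGE-13 RECORD FROM THE FLOOR-CARRYING (8) `CoP` SENTENCE `VariationalThm1RegSepCoP7MR … c …` AND THE R GAUGE `CoP`
SENTENCE AT CUBE LETTER `θ.τ9.M` AND FLOOR `c`, FOR A PARAMETER MEETING THE FLOOR (`hc : c ≤ θ.ν.M₁`), ON EVERY FAMILY** — dag-n21-c's
`Stage13Params.bgAtDatumCoP_of_thm1RegSepCoP7M_of_thm1GaugeR_allTorus` (p575996 §2: the non-wrapping binder `hsN` DERIVED from `PartCompat₁₃` and (C1) via `hsN_of_partCompat₁₃`,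
row `hM`'s letter `∃ a, θ.τ9.M = F.L ^ a` in its place) with `h15` FLOOR-CARRYING at the floor the lemma already carries for `h15G` — the one application re-sourced to n07-e's module 50
`bgRowAtDatumCoP_of_thm1RegSepCoP7MR_of_thm1GaugeR`; every other letter and the proof VERBATIM.  A REDUCTION: both sentences are hypotheses, never asserted.
[cite: Balaban1985Variational, (6)–(7) p.278, Thm 1 (8)–(9) p.279, (152) p.301, Prop. 8 p.304, p.304 lines 1–2; Balaban1985RegularSpaces, (1.3)–(1.9) p.77, Prop. 6 p.99; Balaban1988Convergent, Thm 1 p.262, (2.1) p.254, (2.4)–(2.8) pp.255–256, (2.12)–(2.13) pp.256–257, p.257, (2.27)–(2.28) p.259, (2.34)–(2.41) p.261; Balaban1987RG1, (1.11)–(1.12) p.262] -/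
theorem bgAtDatumCoP_of_thm1RegSepCoP7MR_of_thm1GaugeR_allTorus (θ : Stage13Params F N) (hθ : θ.Admissible F N) (hRz : θ.Rz = RzOfRecord F N)
    {c : ℕ} {B₃ B₃' a₀ a₁ : ℝ} (hM : 0 < θ.τ9.M) (hc : c ≤ θ.ν.M₁)
    (h15 : VariationalThm1RegSepCoP7MR F N c B₃ a₀ a₁) (h15G : VariationalThm1GaugeRegSepCoP7MR F N θ.τ9.M c B₃ B₃' a₀ a₁)
    (hnum : ∀ (p : B12.RunParams) (n : ℕ), n ≤ p.K → Step.InInterval θ.γ n (gOfRecord₁₃ F N θ p) → ∀ m, m ≤ n →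
      0 < θ.s2.cR * epsOfRecord θ.ν (gOfRecord₁₃ F N θ p) m ∧ θ.s2.cR * epsOfRecord θ.ν (gOfRecord₁₃ F N θ p) m ≤ a₁ ∧ B₃ * (θ.s2.cR * epsOfRecord θ.ν (gOfRecord₁₃ F N θ p) m) ≤ θ.ν.εreg)
    (ha₀ : θ.ν.εreg ≤ a₀)
    (hcomp : ∀ (p : B12.RunParams) (n : ℕ), n ≤ p.K → Step.InInterval θ.γ n (gOfRecord₁₃ F N θ p) → ∀ m, m < n →
      θ.s2.cR * epsOfRecord θ.ν (gOfRecord₁₃ F N θ p) m ≤ 2 * (θ.s2.cR * epsOfRecord θ.ν (gOfRecord₁₃ F N θ p) (m + 1)))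
    (hcomp' : ∀ (p : B12.RunParams) (n : ℕ), n ≤ p.K → Step.InInterval θ.γ n (gOfRecord₁₃ F N θ p) → ∀ m, m < n →
      θ.s2.cR * epsOfRecord θ.ν (gOfRecord₁₃ F N θ p) (m + 1) ≤ 2 * (θ.s2.cR * epsOfRecord θ.ν (gOfRecord₁₃ F N θ p) m))
    (hBα : ∀ (p : B12.RunParams) (n : ℕ), n ≤ p.K → Step.InInterval θ.γ n (gOfRecord₁₃ F N θ p) → ∀ m, 1 ≤ m → m ≤ n →
      B₃ * (θ.s2.cR * epsOfRecord θ.ν (gOfRecord₁₃ F N θ p) m) ≤ (1 - θ.s2.βc) * (lfOfRecord₁₂ F N θ.toStage12Params).alpha0 (gOfRecord₁₃ F N θ p m))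
    (htI : ∀ (p : B12.RunParams) (n : ℕ), n ≤ p.K → Step.InInterval θ.γ n (gOfRecord₁₃ F N θ p) → ∀ m, 1 ≤ m → m ≤ n →
      B₃' * (θ.s2.cR * epsOfRecord θ.ν (gOfRecord₁₃ F N θ p) m) ≤ θ.s2.cB * (lfOfRecord₁₂ F N θ.toStage12Params).alpha0 (gOfRecord₁₃ F N θ p m))
    (htMS : ∀ (p : B12.RunParams) (n : ℕ), n ≤ p.K → Step.InInterval θ.γ n (gOfRecord₁₃ F N θ p) → ∀ m, 1 ≤ m → m ≤ n →
      B₃' * (θ.s2.cR * epsOfRecord θ.ν (gOfRecord₁₃ F N θ p) m) ≤ θ.s2.B * θ.s2.C * θ.s2.Mr * (lfOfRecord₁₂ F N θ.toStage12Params).alpha0 (gOfRecord₁₃ F N θ p m))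
    (hC1 : ∀ (p : B12.RunParams) (n : ℕ), n ≤ p.K → Step.InInterval θ.γ n (gOfRecord₁₃ F N θ p) → ∀ j, 1 ≤ j → j ≤ n →
      ∃ t : ℕ, 0 < t ∧ RkOfRecord (F.P p.K).L θ.ν.r (gOfRecord₁₃ F N θ p j) = (F.P p.K).L * t)
    (hMa : ∃ a : ℕ, θ.τ9.M = F.L ^ a) :
    ∀ (p : B12.RunParams) (n : ℕ), n ≤ p.K → Step.InInterval θ.γ n (gOfRecord₁₃ F N θ p) → PartCompat₁₃ F N θ p n →
      ∀ s : SeqOfRecord F θ.ν θ.τ9.M (gOfRecord₁₃ F N θ p) p.K n, Sect2.SeqSeparated θ.ν.M₁ s → 0 < θ.ν.M₁ → ∀ W : MSField (F.P p.K) (SU N),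
      Sect2.DataSmall7PTop (avOfRecord F N p.K) s.Ω (suppDomOfRecord F θ.ν p.K s.Ω) n (fun j => θ.s2.cR * epsOfRecord θ.ν (gOfRecord₁₃ F N θ p) j) W →
      ∀ j, 1 ≤ j → j ≤ n → ∀ X : (Sect2.domSys (F.P p.K) θ.τ9.M j).Dom,
      (Sect2.domSites (F.P p.K) θ.τ9.M j X ⊆ s.Λ j →
        Sect2.ofBackgroundC (settingOfRecord₁₃ F N θ p).ι (UbgMSCoPOfRecord F N θ.ν θ.τ9.M (gOfRecord₁₃ F N θ p) p.K n s W) ∈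
          Sect2.spaceI (settingOfRecord₁₃ F N θ p) (θ.Rz p.K) θ.τ9.M j (Sect2.domSites (F.P p.K) θ.τ9.M j X)
            ((settingOfRecord₁₃ F N θ p).lf.alpha0 ((settingOfRecord₁₃ F N θ p).flow.g j)) ((settingOfRecord₁₃ F N θ p).lf.alpha1 ((settingOfRecord₁₃ F N θ p).flow.g j))) ∧
      (Sect2.admB (F.P p.K) θ.ν θ.τ9.M (gOfRecord₁₃ F N θ p) s.Ω s.Λ j (Sect2.domSites (F.P p.K) θ.τ9.M j X) = true →
        Sect2.ofBackgroundC (settingOfRecord₁₃ F N θ p).ι (UbgMSCoPOfRecord F N θ.ν θ.τ9.M (gOfRecord₁₃ F N θ p) p.K n s W) ∈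
          Sect2.spaceMS (settingOfRecord₁₃ F N θ p) (θ.Rz p.K) θ.τ9.M j (Sect2.domSites (F.P p.K) θ.τ9.M j X) s.Ω) := by
  intro p n hn hw hpc s hsep hM₁ W h7
  obtain ⟨a, ha⟩ := hMa
  rcases Nat.eq_zero_or_pos n with rfl | hn1
  · intro j h1 hj; exfalso; omega
  · rw [hRz]
    exact bgRowAtDatumCoP_of_thm1RegSepCoP7MR_of_thm1GaugeR h15 h15G (settingOfRecord₁₃ F N θ p) rfl rfl (settingOfRecord₁₃_laws F N θ p)
      (settingOfRecord₁₃_pos F N θ hθ.1.pos p) θ.ν hM p.K n θ.s2.cR (hnum p n hn hw) ha₀ (hcomp p n hn hw) (hcomp' p n hn hw)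
      (fun m _ hm => alphaPos₁₃_of_inInterval hθ hw hm) (hBα p n hn hw) (htI p n hn hw) (htMS p n hn hw) (hC1 p n hn hw) hpc
      (θ.hsN_of_partCompat₁₃ ha hn1 hpc (hC1 p n hn hw)) s hsep hM₁ hc W h7

end LiftGaugeRAllTorusFloor

/-! ## §2  ★★ At `θ₁₅ᶜᶜᴹ(j; γ)`: the (7)-guarded separated row P11 at the Co carrier from the floor-carrying (8), the R gauge sentence and (hcomp) ∧ (hcompRev), on EVERY family -/

section AtWitnessFloor

variable {F : T4Family} {N : ℕ} [NeZero N] {j c : ℕ} {γ ε₀ ε₂₉ B₃ B₃' a₀ a₁ : ℝ}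

/-- **★★ THE (7)-GUARDED SEPARATED ROW P11 AT THE Co CARRIER AT `θ₁₅ᶜᶜᴹ(j; γ)` FROM `0 < γ ≤ ½`, THE FLOOR-CARRYING (8) AT FLOOR `c ≤ L^j`, THE R GAUGE SENTENCE AT `(L^j, c)` AND
(hcomp) ∧ (hcompRev), ON EVERY FAMILY** — dag-n21-c's `bgSepCoPAt_theta13OfThm1CCMW_of_thm1GaugeR_of_hcomp_allTorus` (p575996 §3) with `h15` floor-carrying at the floor `c` its
`hc : c ≤ F.L ^ j` already binds (the witness meets it: `ν.M₁(θ₁₅ᶜᶜᴹ(j; γ)) = L^j`, A2ʷ `theta13OfThm1CCMW_M₁`); statement otherwise verbatim; §1 at the witness.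
CONDITIONAL; nothing of Bałaban asserted. [cite: Balaban1985Variational, (6)–(7) p.278, Thm 1 (8)–(9) p.279, (144)–(152) pp.300–301, Prop. 8 p.304, p.304 lines 1–2; Balaban1985RegularSpaces, (1.3)–(1.9) p.77; Balaban1988Convergent, Thm 1 p.262, (2.1) p.254, (2.4)–(2.8) pp.255–256, (2.12)–(2.13) pp.256–257, (2.18) p.257, (2.25)–(2.28) pp.258–259; Balaban1987RG1, Thm 1 p.259, (1.12) p.262] -/
theorem bgSepCoPAt_theta13OfThm1CCMW_of_thm1RegSepCoP7MR_of_thm1GaugeR_of_hcomp_allTorus (hγ0 : 0 < γ) (hγ : γ ≤ 1 / 2) (hε : 0 < ε₀) (hε' : 0 < ε₂₉) (hB : 0 ≤ B₃) (hB' : 0 ≤ B₃')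
    (ha₀ : 0 < a₀) (ha₁ : 0 < a₁) (h15 : VariationalThm1RegSepCoP7MR F N c B₃ a₀ a₁) (hc : c ≤ F.L ^ j) (h15G : VariationalThm1GaugeRegSepCoP7MR F N (F.L ^ j) c B₃ B₃' a₀ a₁)
    (hcomp : ∀ (p : B12.RunParams) (n : ℕ), n ≤ p.K → Step.InInterval (theta13OfThm1CCMW F N j γ ε₀ ε₂₉ B₃ B₃' a₀ a₁).γ n (gOfRecord₁₃ F N (theta13OfThm1CCMW F N j γ ε₀ ε₂₉ B₃ B₃' a₀ a₁) p) → ∀ m, m < n →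
      (theta13OfThm1CCMW F N j γ ε₀ ε₂₉ B₃ B₃' a₀ a₁).s2.cR * epsOfRecord (theta13OfThm1CCMW F N j γ ε₀ ε₂₉ B₃ B₃' a₀ a₁).ν (gOfRecord₁₃ F N (theta13OfThm1CCMW F N j γ ε₀ ε₂₉ B₃ B₃' a₀ a₁) p) m ≤ 2 * ((theta13OfThm1CCMW F N j γ ε₀ ε₂₉ B₃ B₃' a₀ a₁).s2.cR * epsOfRecord (theta13OfThm1CCMW F N j γ ε₀ ε₂₉ B₃ B₃' a₀ a₁).ν (gOfRecord₁₃ F N (theta13OfThm1CCMW F N j γ ε₀ ε₂₉ B₃ B₃' a₀ a₁) p) (m + 1)))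
    (hcompRev : ∀ (p : B12.RunParams) (n : ℕ), n ≤ p.K → Step.InInterval (theta13OfThm1CCMW F N j γ ε₀ ε₂₉ B₃ B₃' a₀ a₁).γ n (gOfRecord₁₃ F N (theta13OfThm1CCMW F N j γ ε₀ ε₂₉ B₃ B₃' a₀ a₁) p) → ∀ m, m < n →
      (theta13OfThm1CCMW F N j γ ε₀ ε₂₉ B₃ B₃' a₀ a₁).s2.cR * epsOfRecord (theta13OfThm1CCMW F N j γ ε₀ ε₂₉ B₃ B₃' a₀ a₁).ν (gOfRecord₁₃ F N (theta13OfThm1CCMW F N j γ ε₀ ε₂₉ B₃ B₃' a₀ a₁) p) (m + 1) ≤ 2 * ((theta13OfThm1CCMW F N j γ ε₀ ε₂₉ B₃ B₃' a₀ a₁).s2.cR * epsOfRecord (theta13OfThm1CCMW F N j γ ε₀ ε₂₉ B₃ B₃' a₀ a₁).ν (gOfRecord₁₃ F N (theta13OfThm1CCMW F N j γ ε₀ ε₂₉ B₃ B₃' a₀ a₁) p) m)) :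
    ∀ (p : B12.RunParams) (n : ℕ), n ≤ p.K → Step.InInterval (theta13OfThm1CCMW F N j γ ε₀ ε₂₉ B₃ B₃' a₀ a₁).γ n (gOfRecord₁₃ F N (theta13OfThm1CCMW F N j γ ε₀ ε₂₉ B₃ B₃' a₀ a₁) p) → PartCompat₁₃ F N (theta13OfThm1CCMW F N j γ ε₀ ε₂₉ B₃ B₃' a₀ a₁) p n →
      ∀ s : SeqOfRecord F (theta13OfThm1CCMW F N j γ ε₀ ε₂₉ B₃ B₃' a₀ a₁).ν (theta13OfThm1CCMW F N j γ ε₀ ε₂₉ B₃ B₃' a₀ a₁).τ9.M (gOfRecord₁₃ F N (theta13OfThm1CCMW F N j γ ε₀ ε₂₉ B₃ B₃' a₀ a₁) p) p.K n, Sect2.SeqSeparated (theta13OfThm1CCMW F N j γ ε₀ ε₂₉ B₃ B₃' a₀ a₁).ν.M₁ s →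
      ∀ W : MSField (F.P p.K) (SU N), W ∈ suppOfRecord₁₃P F N (theta13OfThm1CCMW F N j γ ε₀ ε₂₉ B₃ B₃' a₀ a₁) p n s →
      Sect2.DataSmall7PTop (avOfRecord F N p.K) s.Ω (suppDomOfRecord F (theta13OfThm1CCMW F N j γ ε₀ ε₂₉ B₃ B₃' a₀ a₁).ν p.K s.Ω) n (fun j' => (theta13OfThm1CCMW F N j γ ε₀ ε₂₉ B₃ B₃' a₀ a₁).s2.cR * epsOfRecord (theta13OfThm1CCMW F N j γ ε₀ ε₂₉ B₃ B₃' a₀ a₁).ν (gOfRecord₁₃ F N (theta13OfThm1CCMW F N j γ ε₀ ε₂₉ B₃ B₃' a₀ a₁) p) j') W →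
      ∀ j', 1 ≤ j' → j' ≤ n → ∀ X : (Sect2.domSys (F.P p.K) (theta13OfThm1CCMW F N j γ ε₀ ε₂₉ B₃ B₃' a₀ a₁).τ9.M j').Dom,
      (Sect2.domSites (F.P p.K) (theta13OfThm1CCMW F N j γ ε₀ ε₂₉ B₃ B₃' a₀ a₁).τ9.M j' X ⊆ s.Λ j' →
        Sect2.ofBackgroundC (settingOfRecord₁₃ F N (theta13OfThm1CCMW F N j γ ε₀ ε₂₉ B₃ B₃' a₀ a₁) p).ι (UbgOfRecord₁₃CoP F N (theta13OfThm1CCMW F N j γ ε₀ ε₂₉ B₃ B₃' a₀ a₁) p n s W) ∈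
          Sect2.spaceI (settingOfRecord₁₃ F N (theta13OfThm1CCMW F N j γ ε₀ ε₂₉ B₃ B₃' a₀ a₁) p) ((theta13OfThm1CCMW F N j γ ε₀ ε₂₉ B₃ B₃' a₀ a₁).Rz p.K) (theta13OfThm1CCMW F N j γ ε₀ ε₂₉ B₃ B₃' a₀ a₁).τ9.M j' (Sect2.domSites (F.P p.K) (theta13OfThm1CCMW F N j γ ε₀ ε₂₉ B₃ B₃' a₀ a₁).τ9.M j' X)
            ((settingOfRecord₁₃ F N (theta13OfThm1CCMW F N j γ ε₀ ε₂₉ B₃ B₃' a₀ a₁) p).lf.alpha0 ((settingOfRecord₁₃ F N (theta13OfThm1CCMW F N j γ ε₀ ε₂₉ B₃ B₃' a₀ a₁) p).flow.g j')) ((settingOfRecord₁₃ F N (theta13OfThm1CCMW F N j γ ε₀ ε₂₉ B₃ B₃' a₀ a₁) p).lf.alpha1 ((settingOfRecord₁₃ F N (theta13OfThm1CCMW F N j γ ε₀ ε₂₉ B₃ B₃' a₀ a₁) p).flow.g j'))) ∧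
      (Sect2.admB (F.P p.K) (theta13OfThm1CCMW F N j γ ε₀ ε₂₉ B₃ B₃' a₀ a₁).ν (theta13OfThm1CCMW F N j γ ε₀ ε₂₉ B₃ B₃' a₀ a₁).τ9.M (gOfRecord₁₃ F N (theta13OfThm1CCMW F N j γ ε₀ ε₂₉ B₃ B₃' a₀ a₁) p) s.Ω s.Λ j' (Sect2.domSites (F.P p.K) (theta13OfThm1CCMW F N j γ ε₀ ε₂₉ B₃ B₃' a₀ a₁).τ9.M j' X) = true →
        Sect2.ofBackgroundC (settingOfRecord₁₃ F N (theta13OfThm1CCMW F N j γ ε₀ ε₂₉ B₃ B₃' a₀ a₁) p).ι (UbgOfRecord₁₃CoP F N (theta13OfThm1CCMW F N j γ ε₀ ε₂₉ B₃ B₃' a₀ a₁) p n s W) ∈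
          Sect2.spaceMS (settingOfRecord₁₃ F N (theta13OfThm1CCMW F N j γ ε₀ ε₂₉ B₃ B₃' a₀ a₁) p) ((theta13OfThm1CCMW F N j γ ε₀ ε₂₉ B₃ B₃' a₀ a₁).Rz p.K) (theta13OfThm1CCMW F N j γ ε₀ ε₂₉ B₃ B₃' a₀ a₁).τ9.M j' (Sect2.domSites (F.P p.K) (theta13OfThm1CCMW F N j γ ε₀ ε₂₉ B₃ B₃' a₀ a₁).τ9.M j' X) s.Ω) := by
  intro p n hn hw hpc s hsep W _ h7
  cases n with
  | zero => intro j' h1 hj'; exfalso; omega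
  | succ n =>
    rw [UbgOfRecord₁₃CoP_succ]
    exact bgAtDatumCoP_of_thm1RegSepCoP7MR_of_thm1GaugeR_allTorus (theta13OfThm1CCMW F N j γ ε₀ ε₂₉ B₃ B₃' a₀ a₁)
      (admissible_theta13OfThm1CCMW_of_le_half F N hγ0 hγ hε hε' hB hB' ha₀ ha₁) rfl
      (τ9_M_pos_theta13OfThm1CCMW F N j γ ε₀ ε₂₉ B₃ B₃' a₀ a₁) (by rw [theta13OfThm1CCMW_M₁]; exact hc) h15 h15G (hnum_theta13OfThm1CCMW hγ hB hB' ha₀ ha₁) εreg_le_theta13OfThm1CCMW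
      hcomp hcompRev (hBα_theta13OfThm1CCMW hγ hB hB' ha₀.le ha₁.le)
      (htI_theta13OfThm1CCMW hγ hB hB' ha₀.le ha₁.le) (htMS_theta13OfThm1CCMW hγ hB hB' ha₀.le ha₁.le) (hC1_theta13OfThm1CCMW hγ) ⟨j, theta13OfThm1CCMW_τ9_M F N j γ ε₀ ε₂₉ B₃ B₃' a₀ a₁⟩
      p (n + 1) hn hw hpc s hsep (M₁_pos_theta13OfThm1CCMW F N j γ ε₀ ε₂₉ B₃ B₃' a₀ a₁) W h7

end AtWitnessFloor

/-! ## §3  Closers keyed on the floor-carrying (8), (hcomp) ∧ (hcompRev), on EVERY family -/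

section ClosersFloor

variable {j c : ℕ} {γ ε₀ ε₂₉ B₃ B₃' a₀ a₁ : ℝ}

/-- **THE v1.5 K0 BODY (⁵) FOR `F` AT `N = 2` AT `θ₁₅ᶜᶜᴹ(j; γ)` FROM `0 < γ ≤ ½`, THE FLOOR-CARRYING (8) AT FLOOR `c ≤ L^j`, THE R GAUGE SENTENCE AND (hcomp) ∧ (hcompRev), ON EVERY FAMILY**
(16a's socket ∘ §2) — p575996 §4's `exists_k0SepCoP_thm1CCMW_of_thm1GaugeR_of_hcomp_allTorus` at `h15R`.  CONDITIONAL; K0 NOT closed here.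
[cite: Balaban1985Variational, Thm 1 (8)–(9) p.279, (152) p.301, Prop. 8 p.304, p.304 lines 1–2; Balaban1988Convergent, Thm 1 p.262, (2.4)–(2.8) pp.255–256, p.257; Balaban1987RG1, Thm 1 p.259] -/
theorem exists_k0SepCoP_thm1CCMW_of_thm1RegSepCoP7MR_of_thm1GaugeR_of_hcomp_allTorus (F : T4Family) (hγ0 : 0 < γ) (hγ : γ ≤ 1 / 2) (hε : 0 < ε₀) (hε' : 0 < ε₂₉) (hB : 0 ≤ B₃)
    (hB' : 0 ≤ B₃') (ha₀ : 0 < a₀) (ha₁ : 0 < a₁) (h15 : VariationalThm1RegSepCoP7MR F 2 c B₃ a₀ a₁) (hc : c ≤ F.L ^ j)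
    (h15G : VariationalThm1GaugeRegSepCoP7MR F 2 (F.L ^ j) c B₃ B₃' a₀ a₁)
    (hcomp : ∀ (p : B12.RunParams) (n : ℕ), n ≤ p.K → Step.InInterval (theta13OfThm1CCMW F 2 j γ ε₀ ε₂₉ B₃ B₃' a₀ a₁).γ n (gOfRecord₁₃ F 2 (theta13OfThm1CCMW F 2 j γ ε₀ ε₂₉ B₃ B₃' a₀ a₁) p) → ∀ m, m < n →
      (theta13OfThm1CCMW F 2 j γ ε₀ ε₂₉ B₃ B₃' a₀ a₁).s2.cR * epsOfRecord (theta13OfThm1CCMW F 2 j γ ε₀ ε₂₉ B₃ B₃' a₀ a₁).ν (gOfRecord₁₃ F 2 (theta13OfThm1CCMW F 2 j γ ε₀ ε₂₉ B₃ B₃' a₀ a₁) p) m ≤ 2 * ((theta13OfThm1CCMW F 2 j γ ε₀ ε₂₉ B₃ B₃' a₀ a₁).s2.cR * epsOfRecord (theta13OfThm1CCMW F 2 j γ ε₀ ε₂₉ B₃ B₃' a₀ a₁).ν (gOfRecord₁₃ F 2 (theta13OfThm1CCMW F 2 j γ ε₀ ε₂₉ B₃ B₃' a₀ a₁) p) (m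 + 1)))
    (hcompRev : ∀ (p : B12.RunParams) (n : ℕ), n ≤ p.K → Step.InInterval (theta13OfThm1CCMW F 2 j γ ε₀ ε₂₉ B₃ B₃' a₀ a₁).γ n (gOfRecord₁₃ F 2 (theta13OfThm1CCMW F 2 j γ ε₀ ε₂₉ B₃ B₃' a₀ a₁) p) → ∀ m, m < n →
      (theta13OfThm1CCMW F 2 j γ ε₀ ε₂₉ B₃ B₃' a₀ a₁).s2.cR * epsOfRecord (theta13OfThm1CCMW F 2 j γ ε₀ ε₂₉ B₃ B₃' a₀ a₁).ν (gOfRecord₁₃ F 2 (theta13OfThm1CCMW F 2 j γ ε₀ ε₂₉ B₃ B₃' a₀ a₁) p) (m + 1) ≤ 2 * ((theta13OfThm1CCMW F 2 j γ ε₀ ε₂₉ B₃ B₃' a₀ a₁).s2.cR * epsOfRecord (theta13OfThm1CCMW F 2 j γ ε₀ ε₂₉ B₃ B₃' a₀ a₁).ν (gOfRecord₁₃ F 2 (theta13OfThm1CCMW F 2 j γ ε₀ ε₂₉ B₃ B₃' a₀ a₁) p) m)) :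
    ∃ θ : Stage13Params F 2, θ.Provisos₁₃SepCoP F 2 ∧ (θ.ZtUnity F 2 ∧ θ.SlotsNondegenerate₁₃ F 2) ∧ θ.Admissible F 2 :=
  exists_k0SepCoP_of_bgSepCoP_theta13LiveOfNumerics F (stage12NumericsOfThm1CCMW_pos_of_le_half (L := F.L) (j := j) F.hL.2.le hγ0 hγ hε hB hB' ha₀ ha₁) hε' ⟨j, rfl⟩ (dvd_refl _)
    (bgSepCoPAt_theta13OfThm1CCMW_of_thm1RegSepCoP7MR_of_thm1GaugeR_of_hcomp_allTorus hγ0 hγ hε hε' hB hB' ha₀ ha₁ h15 hc h15G hcomp hcompRev)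

/-- **THE ⁷ IMAGE, ON EVERY FAMILY, FROM THE FLOOR-CARRYING (8)** (FILE 18's cured lift, T's history-blind door) — p575996 §4's `exists_k0SepCoPH_thm1CCMW_of_thm1GaugeR_of_hcomp_allTorus` at `h15R`.
[cite: Balaban1985Variational, Thm 1 (8) p.279, Prop. 8 p.304, p.304 lines 1–2; Balaban1988Convergent, Thm 1 p.262, (2.21) p.258, (3.16)–(3.23) pp.268–270; Balaban1989LargeFieldI, (0.2)–(0.4) p.176] -/
theorem exists_k0SepCoPH_thm1CCMW_of_thm1RegSepCoP7MR_of_thm1GaugeR_of_hcomp_allTorus (F : T4Family) (hγ0 : 0 < γ) (hγ : γ ≤ 1 / 2) (hε : 0 < ε₀) (hε' : 0 < ε₂₉) (hB : 0 ≤ B₃)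
    (hB' : 0 ≤ B₃') (ha₀ : 0 < a₀) (ha₁ : 0 < a₁) (h15 : VariationalThm1RegSepCoP7MR F 2 c B₃ a₀ a₁) (hc : c ≤ F.L ^ j)
    (h15G : VariationalThm1GaugeRegSepCoP7MR F 2 (F.L ^ j) c B₃ B₃' a₀ a₁)
    (hcomp : ∀ (p : B12.RunParams) (n : ℕ), n ≤ p.K → Step.InInterval (theta13OfThm1CCMW F 2 j γ ε₀ ε₂₉ B₃ B₃' a₀ a₁).γ n (gOfRecord₁₃ F 2 (theta13OfThm1CCMW F 2 j γ ε₀ ε₂₉ B₃ B₃' a₀ a₁) p) → ∀ m, m < n →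
      (theta13OfThm1CCMW F 2 j γ ε₀ ε₂₉ B₃ B₃' a₀ a₁).s2.cR * epsOfRecord (theta13OfThm1CCMW F 2 j γ ε₀ ε₂₉ B₃ B₃' a₀ a₁).ν (gOfRecord₁₃ F 2 (theta13OfThm1CCMW F 2 j γ ε₀ ε₂₉ B₃ B₃' a₀ a₁) p) m ≤ 2 * ((theta13OfThm1CCMW F 2 j γ ε₀ ε₂₉ B₃ B₃' a₀ a₁).s2.cR * epsOfRecord (theta13OfThm1CCMW F 2 j γ ε₀ ε₂₉ B₃ B₃' a₀ a₁).ν (gOfRecord₁₃ F 2 (theta13OfThm1CCMW F 2 j γ ε₀ ε₂₉ B₃ B₃' a₀ a₁) p) (m + 1)))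
    (hcompRev : ∀ (p : B12.RunParams) (n : ℕ), n ≤ p.K → Step.InInterval (theta13OfThm1CCMW F 2 j γ ε₀ ε₂₉ B₃ B₃' a₀ a₁).γ n (gOfRecord₁₃ F 2 (theta13OfThm1CCMW F 2 j γ ε₀ ε₂₉ B₃ B₃' a₀ a₁) p) → ∀ m, m < n →
      (theta13OfThm1CCMW F 2 j γ ε₀ ε₂₉ B₃ B₃' a₀ a₁).s2.cR * epsOfRecord (theta13OfThm1CCMW F 2 j γ ε₀ ε₂₉ B₃ B₃' a₀ a₁).ν (gOfRecord₁₃ F 2 (theta13OfThm1CCMW F 2 j γ ε₀ ε₂₉ B₃ B₃' a₀ a₁) p) (m + 1) ≤ 2 * ((theta13OfThm1CCMW F 2 j γ ε₀ ε₂₉ B₃ B₃' a₀ a₁).s2.cR * epsOfRecord (theta13OfThm1CCMW F 2 j γ ε₀ ε₂₉ B₃ B₃' a₀ a₁).ν (gOfRecord₁₃ F 2 (theta13OfThm1CCMW F 2 j γ ε₀ ε₂₉ B₃ B₃' a₀ a₁) p) m)) :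
    ∃ θ : Stage13HParams F 2, θ.Provisos₁₃SepCoPH F 2 ∧ (θ.ZhUnity F 2 ∧ θ.SlotsNondegenerate₁₃ F 2) ∧ θ.Admissible F 2 :=
  exists_k0SepCoPH_of_exists_k0SepCoPR (exists_k0SepCoPR_of_exists_k0SepCoP F
    (exists_k0SepCoP_thm1CCMW_of_thm1RegSepCoP7MR_of_thm1GaugeR_of_hcomp_allTorus F hγ0 hγ hε hε' hB hB' ha₀ ha₁ h15 hc h15G hcomp hcompRev))

/-- **THE ⁷ K0 BODY KEYED ON THE FLOOR-CARRYING (8) AND dag-n07-e's FLOOR-CARRYING (9)-STEP FACT AT `(L^j, c)`, (hcomp) ∧ (hcompRev), ON EVERY FAMILY** (B′ §4: minimal ⇒ critical,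
`variationalThm1GaugeRegSepCoP7MR_of_gauge9TopStepR`) — p575996 §4's `exists_k0SepCoPH_thm1CCMW_of_gauge9TopStepR_of_hcomp_allTorus` at `h15R`.  CONDITIONAL.
[cite: Balaban1985Variational, Thm 1 (8)–(9) p.279, (144)–(152) pp.300–301, Prop. 8 p.304, p.304 lines 1–2; Balaban1988Convergent, Thm 1 p.262, (2.21) p.258, p.257; Balaban1989LargeFieldI, (0.2)–(0.4) p.176] -/
theorem exists_k0SepCoPH_thm1CCMW_of_thm1RegSepCoP7MR_of_gauge9TopStepR_of_hcomp_allTorus (F : T4Family) (hγ0 : 0 < γ) (hγ : γ ≤ 1 / 2) (hε : 0 < ε₀) (hε' : 0 < ε₂₉)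
    (hB : 0 ≤ B₃) (hB' : 0 ≤ B₃') (ha₀ : 0 < a₀) (ha₁ : 0 < a₁) (h15 : VariationalThm1RegSepCoP7MR F 2 c B₃ a₀ a₁) (hc : c ≤ F.L ^ j)
    (h9 : Gauge9RegSepTopStepR F 2 (fun ν K Ω => suppDomOfRecord F ν K Ω) (F.L ^ j) c B₃ B₃' a₀ a₁)
    (hcomp : ∀ (p : B12.RunParams) (n : ℕ), n ≤ p.K → Step.InInterval (theta13OfThm1CCMW F 2 j γ ε₀ ε₂₉ B₃ B₃' a₀ a₁).γ n (gOfRecord₁₃ F 2 (theta13OfThm1CCMW F 2 j γ ε₀ ε₂₉ B₃ B₃' a₀ a₁) p) → ∀ m, m < n →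
      (theta13OfThm1CCMW F 2 j γ ε₀ ε₂₉ B₃ B₃' a₀ a₁).s2.cR * epsOfRecord (theta13OfThm1CCMW F 2 j γ ε₀ ε₂₉ B₃ B₃' a₀ a₁).ν (gOfRecord₁₃ F 2 (theta13OfThm1CCMW F 2 j γ ε₀ ε₂₉ B₃ B₃' a₀ a₁) p) m ≤ 2 * ((theta13OfThm1CCMW F 2 j γ ε₀ ε₂₉ B₃ B₃' a₀ a₁).s2.cR * epsOfRecord (theta13OfThm1CCMW F 2 j γ ε₀ ε₂₉ B₃ B₃' a₀ a₁).ν (gOfRecord₁₃ F 2 (theta13OfThm1CCMW F 2 j γ ε₀ ε₂₉ B₃ B₃' a₀ a₁) p) (m + 1)))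
    (hcompRev : ∀ (p : B12.RunParams) (n : ℕ), n ≤ p.K → Step.InInterval (theta13OfThm1CCMW F 2 j γ ε₀ ε₂₉ B₃ B₃' a₀ a₁).γ n (gOfRecord₁₃ F 2 (theta13OfThm1CCMW F 2 j γ ε₀ ε₂₉ B₃ B₃' a₀ a₁) p) → ∀ m, m < n →
      (theta13OfThm1CCMW F 2 j γ ε₀ ε₂₉ B₃ B₃' a₀ a₁).s2.cR * epsOfRecord (theta13OfThm1CCMW F 2 j γ ε₀ ε₂₉ B₃ B₃' a₀ a₁).ν (gOfRecord₁₃ F 2 (theta13OfThm1CCMW F 2 j γ ε₀ ε₂₉ B₃ B₃' a₀ a₁) p) (m + 1) ≤ 2 * ((theta13OfThm1CCMW F 2 j γ ε₀ ε₂₉ B₃ B₃' a₀ a₁).s2.cR * epsOfRecord (theta13OfThm1CCMW F 2 j γ ε₀ ε₂₉ B₃ B₃' a₀ a₁).ν (gOfRecord₁₃ F 2 (theta13OfThm1CCMW F 2 j γ ε₀ ε₂₉ B₃ B₃' a₀ a₁) p) m)) :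
    ∃ θ : Stage13HParams F 2, θ.Provisos₁₃SepCoPH F 2 ∧ (θ.ZhUnity F 2 ∧ θ.SlotsNondegenerate₁₃ F 2) ∧ θ.Admissible F 2 :=
  exists_k0SepCoPH_thm1CCMW_of_thm1RegSepCoP7MR_of_thm1GaugeR_of_hcomp_allTorus F hγ0 hγ hε hε' hB hB' ha₀ ha₁ h15 hc
    (variationalThm1GaugeRegSepCoP7MR_of_gauge9TopStepR h9) hcomp hcompRev

end ClosersFloor

/-! ## §4  PART 1 re-keyed: the body at an arbitrary cube letter `(L^j, c)`, the stub-level composition with a GENERIC R-supplier, NODE O's socket on the R text -/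

section Part1Floor

/-- **★ THE ⁷ K0 BODY FOR `F` AT AN ARBITRARY CUBE LETTER `(L^j, c)` WITH `c ≤ L^j`, FROM THE FLOOR-CARRYING (8) AT FLOOR `c`, THE (9)-TOKEN AT `(L^j, c)` AND ONE ABS β-BOX OF
`θ₁₅ᶜᶜᴹ(j)`** — PART 1's `exists_k0H_of_thm1CoP7M_of_gauge9R_of_absBox` (p589753 §2) at `h15R`: PART 1 §1 `clausesH_of_absBox` (token-free) gives (hcomp) ∧ (hcompRev) at
`θ₁₅ᶜᶜᴹᵂ(j; γ)`, then §3.  CONDITIONAL. [cite: Balaban1985Variational, Thm 1 (8)–(9) p.279, (144)–(152) pp.300–301, Prop. 8 p.304, p.304 lines 1–2; Balaban1988Convergent, Thm 1 p.262, (2.6)–(2.8) pp.255–256, p.257, (2.21) p.258; Balaban1987RG1, Thm 1 p.259, (1.12) p.262, §1 p.264] -/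
theorem exists_k0H_of_thm1CoP7MR_of_gauge9R_of_absBox (F : T4Family) {j c : ℕ} (hc : c ≤ F.L ^ j) {B₃ B₉ a₀ a₁ : ℝ} (hB₃ : 0 ≤ B₃) (hB₉ : 0 ≤ B₉)
    (ha₀ : 0 < a₀) (ha₁ : 0 < a₁) (h15 : VariationalThm1RegSepCoP7MR F 2 c B₃ a₀ a₁)
    (h9 : Gauge9RegSepTopStepR F 2 (fun ν K Ω => suppDomOfRecord F ν K Ω) (F.L ^ j) c B₃ B₉ a₀ a₁)
    (h3A : ∃ γ₀ ε₀ ε₂₉ β' : ℝ, 0 < γ₀ ∧ 0 < ε₀ ∧ 0 < ε₂₉ ∧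
        BetaLowerH (-β') γ₀ (betaOfRecord₁₃ F 2 (theta13OfThm1CCM F 2 j ε₀ ε₂₉ B₃ B₉ a₀ a₁)) ∧
        BetaUpperH β' γ₀ (betaOfRecord₁₃ F 2 (theta13OfThm1CCM F 2 j ε₀ ε₂₉ B₃ B₉ a₀ a₁))) :
    ∃ θ : Stage13HParams F 2, θ.Provisos₁₃SepCoPH F 2 ∧ (θ.ZhUnity F 2 ∧ θ.SlotsNondegenerate₁₃ F 2) ∧ θ.Admissible F 2 := by
  obtain ⟨γ, ε₀, ε₂₉, hγ0, hγ, hε, hε', hcomp, hcompRev⟩ := clausesH_of_absBox F j hB₃ hB₉ ha₀.le ha₁.le h3A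
  exact exists_k0SepCoPH_thm1CCMW_of_thm1RegSepCoP7MR_of_gauge9TopStepR_of_hcomp_allTorus F hγ0 hγ hε hε' hB₃ hB₉ ha₀ ha₁ h15 hc h9 hcomp hcompRev

/-- **★★ K0⁷'s BODY AT EVERY FAMILY FROM V20-R's STUB 1, A GENERIC FLOOR-CARRYING (9)-SUPPLIER, AND V20-R's 3ᴬ′** — PART 1's `record13SepCoPHBody_of_stub1_of_gauge9Supplier_of_absBetaBoxAt`
(p589753 §3) re-keyed: `h1R` = the V20 option-R stub-1 text VERBATIM ([15] Prop. 8's top step at the record's support selector for SOME floor `c` and guarded `(B₃, a₀, a₁)`, the floor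
∃-bound OUTERMOST); `hSR` = «for every family, floor `c` and guarded `(B₃, a₀, a₁)` carrying the floor-carrying top step, SOME cube letter `(j, c′)` with `c ≤ c′ ≤ L^j`, some `B₉ > 0`
and a ceiling `0 < a₁′ ≤ a₁` carry the floor-carrying (9)-token at `(L^j, c′)`» (PART 2-R instantiates it from stub 2′ at `j := ρ₀ + 3 + c`, `c′ := max c ((11·4 + 4ρ₀L)·L)` through n07-e's
module 48 `gauge9RP_of_prop8TopStepR_of_prop6P_of_one_le`); `h3A'R` = 3ᴬ′ with the FIRST antecedent floor-carrying at the SAME `c` as the (9)-antecedent (n07-e's letter).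
Proof: stub 1 ⇒ the (8) `CoP` sentence at floor `c` (`variationalThm1RegSepCoP7MR_of_prop8TopStepR`, ceiling shrunk by `.of_le`, floor raised to `c′` by `.mono_floor`), `hSR` ⇒ (9) at
`(L^j, c′)`, `h3A'R` there ⇒ the box ⇒ `exists_k0H_of_thm1CoP7MR_of_gauge9R_of_absBox`.  CONDITIONAL; K0⁷ NOT closed here; nothing of Bałaban asserted.
[cite: Balaban1985Variational, Thm 1 (8)–(9) p.279, (144)–(152) pp.300–301, Prop. 8 p.304, p.304 lines 1–2; Balaban1985RegularSpaces, (1.3)–(1.6) p.77, Prop. 6 p.99, p.98; Balaban1988Convergent, Thm 1 p.262, (2.6)–(2.8) pp.255–256, p.257; Balaban1987RG1, Thm 1 p.259, §1 p.264] -/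
theorem record13SepCoPHBody_of_stub1R_of_gauge9SupplierR_of_absBetaBoxAtR
    (h1R : ∀ F : T4Family, ∃ (c : ℕ) (B₃ a₀ a₁ : ℝ), 2 * (F.L : ℝ) ^ 2 ≤ B₃ ∧ 0 < a₀ ∧ 0 < a₁ ∧
      Prop8RegSepTopStepR F 2 (fun ν K Ω => suppDomOfRecord F ν K Ω) c B₃ a₀ a₁)
    (hSR : ∀ (F : T4Family) (c : ℕ) (B₃ a₀ a₁ : ℝ), 2 * (F.L : ℝ) ^ 2 ≤ B₃ → 0 < a₀ → 0 < a₁ →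
      Prop8RegSepTopStepR F 2 (fun ν K Ω => suppDomOfRecord F ν K Ω) c B₃ a₀ a₁ →
      ∃ (j c' : ℕ) (B₉ a₁' : ℝ), c ≤ c' ∧ c' ≤ F.L ^ j ∧ 0 < B₉ ∧ 0 < a₁' ∧ a₁' ≤ a₁ ∧
        Gauge9RegSepTopStepR F 2 (fun ν K Ω => suppDomOfRecord F ν K Ω) (F.L ^ j) c' B₃ B₉ a₀ a₁')
    (h3A'R : ∀ (F : T4Family) (j c : ℕ) (B₃ B₃' a₀ a₁ : ℝ), c ≤ F.L ^ j → 2 * (F.L : ℝ) ^ 2 ≤ B₃ → 0 < B₃' → 0 < a₀ → 0 < a₁ →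
      VariationalThm1RegSepCoP7MR F 2 c B₃ a₀ a₁ →
      Gauge9RegSepTopStepR F 2 (fun ν K Ω => suppDomOfRecord F ν K Ω) (F.L ^ j) c B₃ B₃' a₀ a₁ →
      ∃ γ₀ ε₀ ε₂₉ β' : ℝ, 0 < γ₀ ∧ 0 < ε₀ ∧ 0 < ε₂₉ ∧
        BetaLowerH (-β') γ₀ (betaOfRecord₁₃ F 2 (theta13OfThm1CCM F 2 j ε₀ ε₂₉ B₃ B₃' a₀ a₁)) ∧
        BetaUpperH β' γ₀ (betaOfRecord₁₃ F 2 (theta13OfThm1CCM F 2 j ε₀ ε₂₉ B₃ B₃' a₀ a₁))) :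
    ∀ F : T4Family, ∃ θ : Stage13HParams F 2, θ.Provisos₁₃SepCoPH F 2 ∧ (θ.ZhUnity F 2 ∧ θ.SlotsNondegenerate₁₃ F 2) ∧ θ.Admissible F 2 := by
  intro F
  obtain ⟨c, B₃, a₀, a₁, hB₃, ha₀, ha₁, h8⟩ := h1R F
  have hL : (0 : ℝ) < (F.L : ℝ) := by exact_mod_cast lt_trans Nat.zero_lt_one F.hL.2
  have hBpos : (0 : ℝ) < B₃ := lt_of_lt_of_le (mul_pos two_pos (pow_pos hL 2)) hB₃
  obtain ⟨j, c', B₉, a₁', hcc', hc', hB₉, ha₁', ha₁'le, h9⟩ := hSR F c B₃ a₀ a₁ hB₃ ha₀ ha₁ h8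
  have h15 : VariationalThm1RegSepCoP7MR F 2 c' B₃ a₀ a₁' :=
    variationalThm1RegSepCoP7MR_of_prop8TopStepR hBpos ((h8.of_le le_rfl ha₁'le).mono_floor hcc')
  exact exists_k0H_of_thm1CoP7MR_of_gauge9R_of_absBox F hc' hBpos.le hB₉.le ha₀ ha₁' h15 h9 (h3A'R F j c' B₃ B₉ a₀ a₁' hc' hB₃ hB₉ ha₀ ha₁' h15 h9)

/-- **NODE O's JETS-FREE PAIR AT A1's WITNESS `θ₁₅ᶜᶜᴹ(j)` SUPPLIES V20-R's 3ᴬ′ AT THE CUBE LETTER `(j, c)`** — PART 1 §4's `absBetaBoxAt_of_jetsFreePairAt` with the first antecedent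
floor-carrying (`VariationalThm1RegSepCoP7MR F 2 c B₃ a₀ a₁`); N26's `exists_betaBox_betaOfRecord₁₃_of_jetsFreePair` is θ-generic, so the proof is the same three lines.
CONDITIONAL on the pair; NOT proved; no sign; nothing of Bałaban asserted.
[cite: Balaban1987RG1, Thm 2 p.259, §1 p.264, (2.12)–(2.14) p.268, (5.10) p.293; Balaban1988RG2Cluster, Lemma 3 (2.38) p.20; Balaban1985Variational, Thm 1 p.279, Prop. 8 p.304, p.304 lines 1–2] -/
theorem absBetaBoxAtR_of_jetsFreePairAtR (F : T4Family) (j c : ℕ)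
    (h : ∀ B₃ B₃' a₀ a₁ : ℝ, 2 * (F.L : ℝ) ^ 2 ≤ B₃ → 0 < B₃' → 0 < a₀ → 0 < a₁ →
      VariationalThm1RegSepCoP7MR F 2 c B₃ a₀ a₁ →
      Gauge9RegSepTopStepR F 2 (fun ν K Ω => suppDomOfRecord F ν K Ω) (F.L ^ j) c B₃ B₃' a₀ a₁ →
      ∃ ε₀ ε₂₉ : ℝ, 0 < ε₀ ∧ 0 < ε₂₉ ∧
        (letI := (theta13OfThm1CCM F 2 j ε₀ ε₂₉ B₃ B₃' a₀ a₁).instVβ₁; letI := (theta13OfThm1CCM F 2 j ε₀ ε₂₉ B₃ B₃' a₀ a₁).instVβ₂;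
         letI := (theta13OfThm1CCM F 2 j ε₀ ε₂₉ B₃ B₃' a₀ a₁).instιβ
         ∃ d A : ℝ, 0 ≤ d ∧
           OneLoopDrift d A (beta0OfMerged (betaMerged F (mergedTermFamilyMatT F 2 (TcanOfRecord F 2)
             (chiFixed29 F 2 (theta13OfThm1CCM F 2 j ε₀ ε₂₉ B₃ B₃' a₀ a₁).ν (theta13OfThm1CCM F 2 j ε₀ ε₂₉ B₃ B₃' a₀ a₁).ε₂₉) (theta13OfThm1CCM F 2 j ε₀ ε₂₉ B₃ B₃' a₀ a₁).εbg)
             (theta13OfThm1CCM F 2 j ε₀ ε₂₉ B₃ B₃' a₀ a₁).ρ8 (theta13OfThm1CCM F 2 j ε₀ ε₂₉ B₃ B₃' a₀ a₁).bV) (theta13OfThm1CCM F 2 j ε₀ ε₂₉ B₃ B₃' a₀ a₁).v₀) ∧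
           ∃ γ₀ : ℝ, 0 < γ₀ ∧ γ₀ ≤ (theta13OfThm1CCM F 2 j ε₀ ε₂₉ B₃ B₃' a₀ a₁).γ ∧
             AtSlopeCont
               (oneLoopSplit_betaOfMerged
                 (betaMerged F (mergedTermFamilyMatT F 2 (TcanOfRecord F 2)
                   (chiFixed29 F 2 (theta13OfThm1CCM F 2 j ε₀ ε₂₉ B₃ B₃' a₀ a₁).ν (theta13OfThm1CCM F 2 j ε₀ ε₂₉ B₃ B₃' a₀ a₁).ε₂₉) (theta13OfThm1CCM F 2 j ε₀ ε₂₉ B₃ B₃' a₀ a₁).εbg)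
                   (theta13OfThm1CCM F 2 j ε₀ ε₂₉ B₃ B₃' a₀ a₁).ρ8 (theta13OfThm1CCM F 2 j ε₀ ε₂₉ B₃ B₃' a₀ a₁).bV)
                 (beta0OfMerged (betaMerged F (mergedTermFamilyMatT F 2 (TcanOfRecord F 2)
                   (chiFixed29 F 2 (theta13OfThm1CCM F 2 j ε₀ ε₂₉ B₃ B₃' a₀ a₁).ν (theta13OfThm1CCM F 2 j ε₀ ε₂₉ B₃ B₃' a₀ a₁).ε₂₉) (theta13OfThm1CCM F 2 j ε₀ ε₂₉ B₃ B₃' a₀ a₁).εbg)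
                   (theta13OfThm1CCM F 2 j ε₀ ε₂₉ B₃ B₃' a₀ a₁).ρ8 (theta13OfThm1CCM F 2 j ε₀ ε₂₉ B₃ B₃' a₀ a₁).bV) (theta13OfThm1CCM F 2 j ε₀ ε₂₉ B₃ B₃' a₀ a₁).v₀)
                 (theta13OfThm1CCM F 2 j ε₀ ε₂₉ B₃ B₃' a₀ a₁).γ)
               γ₀ d)) :
    ∀ B₃ B₃' a₀ a₁ : ℝ, 2 * (F.L : ℝ) ^ 2 ≤ B₃ → 0 < B₃' → 0 < a₀ → 0 < a₁ →
      VariationalThm1RegSepCoP7MR F 2 c B₃ a₀ a₁ →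
      Gauge9RegSepTopStepR F 2 (fun ν K Ω => suppDomOfRecord F ν K Ω) (F.L ^ j) c B₃ B₃' a₀ a₁ →
      ∃ γ₀ ε₀ ε₂₉ β' : ℝ, 0 < γ₀ ∧ 0 < ε₀ ∧ 0 < ε₂₉ ∧
        BetaLowerH (-β') γ₀ (betaOfRecord₁₃ F 2 (theta13OfThm1CCM F 2 j ε₀ ε₂₉ B₃ B₃' a₀ a₁)) ∧
        BetaUpperH β' γ₀ (betaOfRecord₁₃ F 2 (theta13OfThm1CCM F 2 j ε₀ ε₂₉ B₃ B₃' a₀ a₁)) := by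
  intro B₃ B₃' a₀ a₁ hB₃ hB₃' ha₀ ha₁ h15 h9
  obtain ⟨ε₀, ε₂₉, hε, hε', hJ⟩ := h B₃ B₃' a₀ a₁ hB₃ hB₃' ha₀ ha₁ h15 h9
  obtain ⟨γ₀, hγ0, -, β', -, hup, hlow, -⟩ := exists_betaBox_betaOfRecord₁₃_of_jetsFreePair F 2 (theta13OfThm1CCM F 2 j ε₀ ε₂₉ B₃ B₃' a₀ a₁) hJ
  exact ⟨γ₀, ε₀, ε₂₉, β', hγ0, hε, hε', hlow, hup⟩

end Part1Floor

/-! ## §5  The direction of the re-text (displayed, kernel): V19 stub 1 ⟹ V20-R stub 1; V20-R 3ᴬ′ ⟹ V19 3ᴬ′ -/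

section Direction

/-- **V19's STUB 1 ⟹ V20-R's STUB 1 AT `F`** (any floor, e.g. `c = 0`: the floor only WEAKENS Prop. 8's top step, module 46 `Prop8RegSepTopStep.toR`) — so a by-name proof of V19's
stub 1 still lands on the R text; never conversely (the R text does not ask the wrapped∕thin-collar prefixes `ν.M₁ < c`). [cite: Balaban1985Variational, Prop. 8 p.304, p.304 lines 1–2 (bookkeeping); Balaban1985RegularSpaces, (1.3)–(1.6) p.77] -/
theorem prop8StepCoPR_of_prop8StepCoP (F : T4Family)
    (h1 : ∃ B₃ a₀ a₁ : ℝ, 2 * (F.L : ℝ) ^ 2 ≤ B₃ ∧ 0 < a₀ ∧ 0 < a₁ ∧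
      Prop8RegSepTopStep F 2 (fun ν K Ω => suppDomOfRecord F ν K Ω) B₃ a₀ a₁) :
    ∃ (c : ℕ) (B₃ a₀ a₁ : ℝ), 2 * (F.L : ℝ) ^ 2 ≤ B₃ ∧ 0 < a₀ ∧ 0 < a₁ ∧
      Prop8RegSepTopStepR F 2 (fun ν K Ω => suppDomOfRecord F ν K Ω) c B₃ a₀ a₁ := by
  obtain ⟨B₃, a₀, a₁, hB₃, ha₀, ha₁, h8⟩ := h1
  exact ⟨0, B₃, a₀, a₁, hB₃, ha₀, ha₁, h8.toR 0⟩

/-- **V20-R's 3ᴬ′ ⟹ V19's 3ᴬ′ AT `F`** (the floor-free (8) gives the floor-carrying one at every floor, module 49 `VariationalThm1RegSepCoP7M.toR`) — the R text of stub 3 is the STRONGER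
stub (the box is demanded from the WEAKER first antecedent); displayed honestly: NODE O's road reads the (8)-sentence, if at all, at the witness's own numerics `ν.M₁ = L^j ≥ c`.
[cite: Balaban1987RG1, §1 p.264 (bookkeeping); Balaban1985Variational, Thm 1 (8) p.279, p.304 lines 1–2] -/
theorem absBetaBoxAtGen_of_absBetaBoxAtGenR (F : T4Family)
    (h3A'R : ∀ (j c : ℕ) (B₃ B₃' a₀ a₁ : ℝ), c ≤ F.L ^ j → 2 * (F.L : ℝ) ^ 2 ≤ B₃ → 0 < B₃' → 0 < a₀ → 0 < a₁ →
      VariationalThm1RegSepCoP7MR F 2 c B₃ a₀ a₁ →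
      Gauge9RegSepTopStepR F 2 (fun ν K Ω => suppDomOfRecord F ν K Ω) (F.L ^ j) c B₃ B₃' a₀ a₁ →
      ∃ γ₀ ε₀ ε₂₉ β' : ℝ, 0 < γ₀ ∧ 0 < ε₀ ∧ 0 < ε₂₉ ∧
        BetaLowerH (-β') γ₀ (betaOfRecord₁₃ F 2 (theta13OfThm1CCM F 2 j ε₀ ε₂₉ B₃ B₃' a₀ a₁)) ∧
        BetaUpperH β' γ₀ (betaOfRecord₁₃ F 2 (theta13OfThm1CCM F 2 j ε₀ ε₂₉ B₃ B₃' a₀ a₁))) :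
    ∀ (j c : ℕ) (B₃ B₃' a₀ a₁ : ℝ), c ≤ F.L ^ j → 2 * (F.L : ℝ) ^ 2 ≤ B₃ → 0 < B₃' → 0 < a₀ → 0 < a₁ →
      VariationalThm1RegSepCoP7M F 2 B₃ a₀ a₁ →
      Gauge9RegSepTopStepR F 2 (fun ν K Ω => suppDomOfRecord F ν K Ω) (F.L ^ j) c B₃ B₃' a₀ a₁ →
      ∃ γ₀ ε₀ ε₂₉ β' : ℝ, 0 < γ₀ ∧ 0 < ε₀ ∧ 0 < ε₂₉ ∧
        BetaLowerH (-β') γ₀ (betaOfRecord₁₃ F 2 (theta13OfThm1CCM F 2 j ε₀ ε₂₉ B₃ B₃' a₀ a₁)) ∧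
        BetaUpperH β' γ₀ (betaOfRecord₁₃ F 2 (theta13OfThm1CCM F 2 j ε₀ ε₂₉ B₃ B₃' a₀ a₁)) :=
  fun j c B₃ B₃' a₀ a₁ hc hB₃ hB₃' ha₀ ha₁ h15 h9 => h3A'R j c B₃ B₃' a₀ a₁ hc hB₃ hB₃' ha₀ ha₁ (h15.toR c) h9

end Direction

end Summit.QuantumFields.YangMills.Theorems.K0AllTorusOfStepTokensRFloor

end
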